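import Summits.NavierStokesRegularity.NavierStokesRegularity.Theorems.CoreLogGasBlowupIsLocallyDrivenStubFarSupportGrad
import Literature.Analysis.FluidPDE.VorticityDirectionDepletion
import Literature.Analysis.FluidPDE.NewtonPotentialHolder

/-!
# Crux `CoreLogGas.BlowupIsLocallyDriven` (stmt-NavierStokesRegularity-11291): Constantin–Fefferman depletion of the
# far-field stretching at the crux's scale

`--supports stmt-NavierStokesRegularity-11291` (lead `prover-line-stmt-NavierStokesRegularity-11291-c5-0`, 2026-08-17).

Context. The crux B bounds, at a deep near-maximum vorticity point `x` with canonical core radius `ρ`, the quadratic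
form `⟪D e, e⟫` of the velocity gradient `D` induced at `x` by the vorticity OUTSIDE `B(x, Mρ)` (resp., after the
landed far-field reduction, by the vorticity in the shell `B(x,R) ∖ B(x,Mρ)`). B as filed (one fixed `M`, absolute
`L¹(dt)` bound) is unreachable (p156404, p154961); the repaired texts (`Cruxes/BlowupIsLocallyDriven/RestatementC4.lean`)
are the scale-free modulus `B_rate2` (all unit `e`) and its STRETCHING-DIRECTION variant `B_rate2_xi` (`e = ξ(t,x)`,
the direction of `ω(t,x)`; only `⟪D ξ, ξ⟫` amplifies `|ω|` at a maximum point). This file supplies the tool that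
separates the two and that any line for the re-typed crux will use first: for a far field — an integrable vorticity
`F` vanishing on a ball `B(x, δ)` — the quadratic form of `∇(K ∗ F)(x)` in a unit direction `e` is an absolutely
convergent integral against the DERIVATIVE of the Biot–Savart kernel, and that kernel annihilates the component of
`F` parallel to `e` (Constantin–Fefferman 1993, §2; Constantin 1994: `⟪S ξ, ξ⟫` sees far vorticity only through
`|sin ∠(ω(y), ξ(x))|`). Hence:

* `hasFDerivAt_biotSavart_farField` — `∇(K ∗ F)(x) = ∫ (∇K(x − y) ·)(F y) dy` with the TRUE kernel derivative
  (the landed `Registered.farSupportGrad_hasFDerivAt_truncPotential` differentiates the smoothly truncated kernel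
  `K_{δ/4}`; off `B(0, δ/2)` it is `K`, and `F = 0` where they differ);
* `inner_fderiv_biotSavart_farField` — `⟪∇(K ∗ F)(x) e, e⟫ = ∫ ⟪e, (∇K(x − y) e)(F y)⟫ dy`;
* `abs_inner_fderiv_biotSavart_farField_le_integral` — **depletion**:
  `|⟪∇(K ∗ F)(x) e, e⟫| ≤ A ∫ ‖F y − ⟪F y, e⟫ e‖ |x − y|⁻³ dy` (`A` the size constant of the `C¹` singular kernel
  `K`; only the component of `F` orthogonal to `e` is seen), and the majorant form `… ≤ ∫ g`;
* `inner_fderiv_biotSavart_farField_eq_zero_of_parallel` — a far field everywhere parallel to `e` does not stretch in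
  the direction `e` at all (straight tubes, antiparallel pairs, unidirectional layers: the refuters' off-axis-tube
  `0.37/M⁴`, pair `3Γd²/(16πM⁴ρ⁴)` and flat-sheet `(2/π)/M` constants are TRANSVERSE strain, invisible to `B_rate2_xi`);
* `abs_inner_fderiv_biotSavart_farField_le_rate` / `farFieldStretch_rate` — **the `M⁻²` law from direction
  coherence**: if beyond `B(x, Mρ)` the orthogonal component decays like `‖F_⊥(y)‖ ≤ m ρ² |x − y|⁻²`, then
  `|⟪∇(K ∗ F)(x) e, e⟫| ≤ (3|B₁|/2) A · m / M²` (`∫_{|z| ≥ Mρ} |z|⁻⁵ dz = (3|B₁|/2)(Mρ)⁻²`), i.e. exactly the rate the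
  re-typed crux asks for, with NO time integrability involved.

The crux-vocabulary versions (the shell gradient `∇BS[1_{B(x,R)}ω](x) − ∇BS[1_{B(x,Mρ)}ω](x)` written out as in the
route decl) are in the companion file `CoreLogGasBlowupIsLocallyDrivenShellStretchingDepletion.lean`.

References: P. Constantin, C. Fefferman, Indiana Univ. Math. J. 42 (1993) 775–789, §2; P. Constantin, SIAM Review 36
(1994) 73–98; A. J. Majda, A. L. Bertozzi, *Vorticity and Incompressible Flow* (CUP 2002), (2.94)–(2.95), (4.30)–(4.31);
D. Gilbarg, N. S. Trudinger, *Elliptic PDE of Second Order* (2001), §4.1.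
-/

noncomputable section

open Set MeasureTheory Filter Topology Metric
open scoped RealInnerProductSpace

-- justification: the namespace is fixed by the crux protocol (sibling files of this crux use `…Theorems.BlowupIsLocallyDriven.*`).
set_option linter.dupNamespace false

namespace Summit.NavierStokesRegularity.NavierStokesRegularity.Theorems.BlowupIsLocallyDriven.Depletion

open Literature.Analysis.FluidPDE
open Summit.NavierStokesRegularity.NavierStokesRegularity.Theorems.BlowupIsLocallyDriven.Registered

/-! ### The true kernel derivative off the truncation ball -/

/-- Off the closed ball of radius `2ε` the smoothly truncated kernel coincides with the kernel near the point, so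
`∇K_ε(z) = ∇K(z)` for `2ε < |z|`. [folklore] -/
theorem fderiv_truncKernel_eq_of_lt {V W : Type*} [NormedAddCommGroup V] [NormedSpace ℝ V] [NormedAddCommGroup W]
    [NormedSpace ℝ W] (K : EuclideanSpace ℝ (Fin 3) → V →L[ℝ] W) {ε : ℝ} (hε : 0 < ε)
    {z : EuclideanSpace ℝ (Fin 3)} (hz : 2 * ε < ‖z‖) :
    fderiv ℝ (truncKernel K ε) z = fderiv ℝ K z := by
  apply Filter.EventuallyEq.fderiv_eq
  have ho : IsOpen {w : EuclideanSpace ℝ (Fin 3) | 2 * ε < ‖w‖} := isOpen_lt continuous_const continuous_norm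
  filter_upwards [ho.mem_nhds hz] with w hw
  exact truncKernel_eq K hε (le_of_lt hw)

/-- For a field `F` vanishing on `B(x, δ)` the derivative integrands of the truncated kernel `K_{δ/4}` and of the
Biot–Savart kernel `K` agree at EVERY `y`: inside the ball both vanish with `F y`, outside `|x − y| ≥ δ > δ/2`.
[folklore] -/
theorem fderiv_truncKernel_flip_eq_of_eqOn_ball {F : EuclideanSpace ℝ (Fin 3) → EuclideanSpace ℝ (Fin 3)}
    {x : EuclideanSpace ℝ (Fin 3)} {δ : ℝ} (hδ : 0 < δ) (hF0 : ∀ y ∈ ball x δ, F y = 0)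
    (y : EuclideanSpace ℝ (Fin 3)) :
    (fderiv ℝ (truncKernel biotSavartCLM (δ / 4)) (x - y)).flip (F y) =
      (fderiv ℝ biotSavartCLM (x - y)).flip (F y) := by
  by_cases hy : y ∈ ball x δ
  · simp [hF0 y hy]
  · have hfar : 2 * (δ / 4) < ‖x - y‖ := by
      rw [mem_ball, dist_eq_norm, not_lt, norm_sub_rev] at hy
      linarith
    rw [fderiv_truncKernel_eq_of_lt biotSavartCLM (by positivity) hfar]

/-- The derivative integrand of the regularised potential of an integrable density is integrable:
`‖(∇K_ε(x − y) ·)(F y)‖ ≤ A(1 + 2B) ε⁻³ ‖F y‖`. [folklore] -/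
theorem integrable_fderiv_truncKernel_flip {A : ℝ} (hK : IsC1SingularKernel biotSavartCLM A) {ε : ℝ} (hε : 0 < ε)
    {F : EuclideanSpace ℝ (Fin 3) → EuclideanSpace ℝ (Fin 3)} (hFi : Integrable F) (x : EuclideanSpace ℝ (Fin 3)) :
    Integrable fun y => (fderiv ℝ (truncKernel biotSavartCLM ε) (x - y)).flip (F y) := by
  obtain ⟨B, hB0, hB⟩ := exists_norm_fderiv_radialCutoff_le
  refine (hFi.norm.const_mul (A * (1 + 2 * B) * (ε ^ 3)⁻¹)).mono'
    (farSupportGrad_aestronglyMeasurable_fderiv_truncKernel_flip hK hε hFi.aestronglyMeasurable x)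
    (Eventually.of_forall fun y => ?_)
  calc ‖(fderiv ℝ (truncKernel biotSavartCLM ε) (x - y)).flip (F y)‖
      ≤ ‖(fderiv ℝ (truncKernel biotSavartCLM ε) (x - y)).flip‖ * ‖F y‖ := ContinuousLinearMap.le_opNorm _ _
    _ = ‖fderiv ℝ (truncKernel biotSavartCLM ε) (x - y)‖ * ‖F y‖ := by rw [ContinuousLinearMap.opNorm_flip]
    _ ≤ A * (1 + 2 * B) * (ε ^ 3)⁻¹ * ‖F y‖ := by
        gcongr
        exact norm_fderiv_truncKernel_le_const hK hB0 hB hε (x - y)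

/-- For a far field `F` (integrable, `= 0` on `B(x, δ)`) the true-kernel derivative integrand
`y ↦ (∇K(x − y) ·)(F y)` is integrable. [folklore] -/
theorem integrable_fderiv_biotSavartCLM_flip {A : ℝ} (hK : IsC1SingularKernel biotSavartCLM A)
    {F : EuclideanSpace ℝ (Fin 3) → EuclideanSpace ℝ (Fin 3)} (hFi : Integrable F)
    {x : EuclideanSpace ℝ (Fin 3)} {δ : ℝ} (hδ : 0 < δ) (hF0 : ∀ y ∈ ball x δ, F y = 0) :
    Integrable fun y => (fderiv ℝ biotSavartCLM (x - y)).flip (F y) :=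
  (integrable_fderiv_truncKernel_flip hK (by positivity : 0 < δ / 4) hFi x).congr
    (Eventually.of_forall fun y => fderiv_truncKernel_flip_eq_of_eqOn_ball hδ hF0 y)

/-- **The gradient of the Biot–Savart velocity of a far field, with the true kernel.** If `F ∈ L¹` vanishes on
`B(x, δ)`, then `K ∗ F` is differentiable at `x` with `∇(K ∗ F)(x) = ∫ (∇K(x − y) ·)(F y) dy`
(Majda–Bertozzi (4.31): `∇K` is homogeneous of degree `−3`, so the integral converges absolutely against `F ∈ L¹`
supported off the ball). [folklore] -/
theorem hasFDerivAt_biotSavart_farField {F : EuclideanSpace ℝ (Fin 3) → EuclideanSpace ℝ (Fin 3)}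
    (hFi : Integrable F) {x : EuclideanSpace ℝ (Fin 3)} {δ : ℝ} (hδ : 0 < δ)
    (hF0 : ∀ y ∈ ball x δ, F y = 0) :
    HasFDerivAt (biotSavart F) (∫ y, (fderiv ℝ biotSavartCLM (x - y)).flip (F y)) x := by
  obtain ⟨A, hK⟩ := exists_isC1SingularKernel_biotSavartCLM
  have hε : 0 < δ / 4 := by positivity
  have hD := (farSupportGrad_hasFDerivAt_truncPotential hK hε hFi x).congr_of_eventuallyEq
    (farSupportGrad_biotSavart_eventuallyEq_truncPotential hδ hF0)
  have heq : (∫ y, (fderiv ℝ (truncKernel biotSavartCLM (δ / 4)) (x - y)).flip (F y)) =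
      ∫ y, (fderiv ℝ biotSavartCLM (x - y)).flip (F y) :=
    integral_congr_ae (Eventually.of_forall fun y => fderiv_truncKernel_flip_eq_of_eqOn_ball hδ hF0 y)
  rwa [heq] at hD

/-- The far-field Biot–Savart velocity is differentiable at the centre of the vorticity-free ball. [folklore] -/
theorem differentiableAt_biotSavart_farField {F : EuclideanSpace ℝ (Fin 3) → EuclideanSpace ℝ (Fin 3)}
    (hFi : Integrable F) {x : EuclideanSpace ℝ (Fin 3)} {δ : ℝ} (hδ : 0 < δ)
    (hF0 : ∀ y ∈ ball x δ, F y = 0) :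
    DifferentiableAt ℝ (biotSavart F) x :=
  (hasFDerivAt_biotSavart_farField hFi hδ hF0).differentiableAt

/-- **Directional derivatives of the far-field velocity**: `∇(K ∗ F)(x) e = ∫ (∇K(x − y) e)(F y) dy`. [folklore] -/
theorem fderiv_biotSavart_farField_apply {F : EuclideanSpace ℝ (Fin 3) → EuclideanSpace ℝ (Fin 3)}
    (hFi : Integrable F) {x : EuclideanSpace ℝ (Fin 3)} {δ : ℝ} (hδ : 0 < δ)
    (hF0 : ∀ y ∈ ball x δ, F y = 0) (e : EuclideanSpace ℝ (Fin 3)) :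
    fderiv ℝ (biotSavart F) x e = ∫ y, (fderiv ℝ biotSavartCLM (x - y) e) (F y) := by
  obtain ⟨A, hK⟩ := exists_isC1SingularKernel_biotSavartCLM
  rw [(hasFDerivAt_biotSavart_farField hFi hδ hF0).fderiv,
    ContinuousLinearMap.integral_apply (integrable_fderiv_biotSavartCLM_flip hK hFi hδ hF0) e]
  rfl

/-- The scalar integrand `y ↦ (∇K(x − y) e)(F y)` of the directional derivative is integrable. [folklore] -/
theorem integrable_fderiv_biotSavartCLM_apply_apply {A : ℝ} (hK : IsC1SingularKernel biotSavartCLM A)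
    {F : EuclideanSpace ℝ (Fin 3) → EuclideanSpace ℝ (Fin 3)} (hFi : Integrable F)
    {x : EuclideanSpace ℝ (Fin 3)} {δ : ℝ} (hδ : 0 < δ) (hF0 : ∀ y ∈ ball x δ, F y = 0)
    (e : EuclideanSpace ℝ (Fin 3)) :
    Integrable fun y => (fderiv ℝ biotSavartCLM (x - y) e) (F y) :=
  (integrable_fderiv_biotSavartCLM_flip hK hFi hδ hF0).apply_continuousLinearMap e

/-- **The stretching form of the far field as a kernel integral**:
`⟪∇(K ∗ F)(x) e, e⟫ = ∫ ⟪e, (∇K(x − y) e)(F y)⟫ dy` (Constantin 1994: the nonlocal representation of the stretching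
rate; here for a far field, where no principal value is needed). [folklore] -/
theorem inner_fderiv_biotSavart_farField {F : EuclideanSpace ℝ (Fin 3) → EuclideanSpace ℝ (Fin 3)}
    (hFi : Integrable F) {x : EuclideanSpace ℝ (Fin 3)} {δ : ℝ} (hδ : 0 < δ)
    (hF0 : ∀ y ∈ ball x δ, F y = 0) (e : EuclideanSpace ℝ (Fin 3)) :
    ⟪fderiv ℝ (biotSavart F) x e, e⟫ = ∫ y, ⟪e, (fderiv ℝ biotSavartCLM (x - y) e) (F y)⟫ := by
  obtain ⟨A, hK⟩ := exists_isC1SingularKernel_biotSavartCLM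
  rw [fderiv_biotSavart_farField_apply hFi hδ hF0 e, real_inner_comm,
    ← integral_inner (integrable_fderiv_biotSavartCLM_apply_apply hK hFi hδ hF0 e) e]

/-! ### Depletion: only the component of the far vorticity orthogonal to `e` stretches in the direction `e` -/

/-- **Depleted far-field stretching bound, majorant form.** For a far field `F` (`L¹`, `= 0` on `B(x,δ)`), a unit
`e`, and any integrable `g` with `A ‖F y − ⟪F y, e⟫ e‖ |x − y|⁻³ ≤ g y` off the ball (and `g ≥ 0` on it):
`|⟪∇(K ∗ F)(x) e, e⟫| ≤ ∫ g` — the kernel of the stretching form annihilates the part of `F y` parallel to `e`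
(`abs_inner_fderiv_biotSavartCLM_apply_le`). [cite: ConstantinFeffermanIndiana1993, §2 (the kernel estimate with the factor |sin φ|)] -/
theorem abs_inner_fderiv_biotSavart_farField_le {A : ℝ} (hK : IsC1SingularKernel biotSavartCLM A)
    {F : EuclideanSpace ℝ (Fin 3) → EuclideanSpace ℝ (Fin 3)} (hFi : Integrable F)
    {x : EuclideanSpace ℝ (Fin 3)} {δ : ℝ} (hδ : 0 < δ) (hF0 : ∀ y ∈ ball x δ, F y = 0)
    {e : EuclideanSpace ℝ (Fin 3)} (he : ‖e‖ = 1) {g : EuclideanSpace ℝ (Fin 3) → ℝ} (hg : Integrable g)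
    (hdom : ∀ y, y ∉ ball x δ → A * ‖F y - ⟪F y, e⟫ • e‖ * (‖x - y‖ ^ 3)⁻¹ ≤ g y)
    (hg0 : ∀ y ∈ ball x δ, 0 ≤ g y) :
    |⟪fderiv ℝ (biotSavart F) x e, e⟫| ≤ ∫ y, g y := by
  rw [inner_fderiv_biotSavart_farField hFi hδ hF0 e, ← Real.norm_eq_abs]
  refine norm_integral_le_of_norm_le hg (Eventually.of_forall fun y => ?_)
  rw [Real.norm_eq_abs]
  by_cases hy : y ∈ ball x δ
  · rw [hF0 y hy, map_zero, inner_zero_right, abs_zero]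
    exact hg0 y hy
  · have hne : x - y ≠ 0 := by
      intro h
      apply hy
      rw [sub_eq_zero] at h
      rw [← h]
      exact mem_ball_self hδ
    exact (abs_inner_fderiv_biotSavartCLM_apply_le hK hne he (F y)).trans (hdom y hy)

/-- `‖w − ⟪w, e⟫ e‖ ≤ 2‖w‖` for a unit `e` (crude bound on the orthogonal component). [folklore] -/
theorem norm_sub_inner_smul_le {e : EuclideanSpace ℝ (Fin 3)} (he : ‖e‖ = 1) (w : EuclideanSpace ℝ (Fin 3)) :
    ‖w - ⟪w, e⟫ • e‖ ≤ 2 * ‖w‖ := by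
  calc ‖w - ⟪w, e⟫ • e‖ ≤ ‖w‖ + ‖⟪w, e⟫ • e‖ := norm_sub_le _ _
    _ ≤ ‖w‖ + ‖w‖ := by
        gcongr
        rw [norm_smul, he, mul_one, Real.norm_eq_abs]
        calc |⟪w, e⟫| ≤ ‖w‖ * ‖e‖ := abs_real_inner_le_norm _ _
          _ = ‖w‖ := by rw [he, mul_one]
    _ = 2 * ‖w‖ := by ring

/-- The orthogonal-component map `w ↦ w − ⟪w, e⟫ e` is continuous. [folklore] -/
theorem continuous_sub_inner_smul (e : EuclideanSpace ℝ (Fin 3)) :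
    Continuous fun w : EuclideanSpace ℝ (Fin 3) => w - ⟪w, e⟫ • e := by
  fun_prop

/-- The depleted majorant `y ↦ A ‖F y − ⟪F y, e⟫ e‖ |x − y|⁻³` of a far field is integrable
(`≤ 2A δ⁻³ ‖F y‖`). [folklore] -/
theorem integrable_depletedMajorant {F : EuclideanSpace ℝ (Fin 3) → EuclideanSpace ℝ (Fin 3)} (hFi : Integrable F)
    {x : EuclideanSpace ℝ (Fin 3)} {δ : ℝ} (hδ : 0 < δ) (hF0 : ∀ y ∈ ball x δ, F y = 0)
    {e : EuclideanSpace ℝ (Fin 3)} (he : ‖e‖ = 1) {A : ℝ} (hA : 0 ≤ A) :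
    Integrable fun y => A * (‖F y - ⟪F y, e⟫ • e‖ * (‖x - y‖ ^ 3)⁻¹) := by
  have h1 : AEStronglyMeasurable (fun y => ‖F y - ⟪F y, e⟫ • e‖) volume :=
    ((continuous_sub_inner_smul e).comp_aestronglyMeasurable hFi.aestronglyMeasurable).norm
  have h2 : Measurable (fun y : EuclideanSpace ℝ (Fin 3) => (‖x - y‖ ^ 3)⁻¹) :=
    ((measurable_const.sub measurable_id).norm.pow_const 3).inv
  have hmeas : AEStronglyMeasurable (fun y => A * (‖F y - ⟪F y, e⟫ • e‖ * (‖x - y‖ ^ 3)⁻¹)) volume :=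
    (h1.mul h2.aestronglyMeasurable).const_mul A
  have hbound : ∀ y, ‖A * (‖F y - ⟪F y, e⟫ • e‖ * (‖x - y‖ ^ 3)⁻¹)‖ ≤ A * 2 * (δ ^ 3)⁻¹ * ‖F y‖ := by
    intro y
    have hn0 : 0 ≤ A * (‖F y - ⟪F y, e⟫ • e‖ * (‖x - y‖ ^ 3)⁻¹) :=
      mul_nonneg hA (mul_nonneg (norm_nonneg _) (inv_nonneg.2 (pow_nonneg (norm_nonneg _) 3)))
    rw [Real.norm_of_nonneg hn0]
    by_cases hy : y ∈ ball x δ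
    · rw [hF0 y hy, inner_zero_left, zero_smul, sub_zero, norm_zero, zero_mul, mul_zero, mul_zero]
    · have hdist : δ ≤ ‖x - y‖ := by
        rw [mem_ball, dist_eq_norm, not_lt, norm_sub_rev] at hy
        exact hy
      have hinv : (‖x - y‖ ^ 3)⁻¹ ≤ (δ ^ 3)⁻¹ := by
        apply inv_anti₀ (pow_pos hδ 3)
        exact pow_le_pow_left₀ hδ.le hdist 3
      have hoc : ‖F y - ⟪F y, e⟫ • e‖ ≤ 2 * ‖F y‖ := norm_sub_inner_smul_le he (F y)
      calc A * (‖F y - ⟪F y, e⟫ • e‖ * (‖x - y‖ ^ 3)⁻¹) ≤ A * ((2 * ‖F y‖) * (δ ^ 3)⁻¹) :=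
            mul_le_mul_of_nonneg_left (mul_le_mul hoc hinv (inv_nonneg.2 (pow_nonneg (norm_nonneg _) 3))
              (mul_nonneg two_pos.le (norm_nonneg _))) hA
        _ = A * 2 * (δ ^ 3)⁻¹ * ‖F y‖ := by ring
  exact (hFi.norm.const_mul (A * 2 * (δ ^ 3)⁻¹)).mono' hmeas (Eventually.of_forall hbound)

/-- **Depleted far-field stretching bound.** For `F ∈ L¹` vanishing on `B(x, δ)` and a unit `e`:
`|⟪∇(K ∗ F)(x) e, e⟫| ≤ A ∫ ‖F y − ⟪F y, e⟫ e‖ |x − y|⁻³ dy` — only the component of the far vorticity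
ORTHOGONAL to `e` stretches in the direction `e`; `‖F y − ⟪F y,e⟫e‖ = |F y| |sin ∠(F y, e)|` is Constantin–Fefferman's
geometric factor. [cite: ConstantinFeffermanIndiana1993, §2 (the kernel estimate with the factor |sin φ|)] -/
theorem abs_inner_fderiv_biotSavart_farField_le_integral {A : ℝ} (hK : IsC1SingularKernel biotSavartCLM A)
    {F : EuclideanSpace ℝ (Fin 3) → EuclideanSpace ℝ (Fin 3)} (hFi : Integrable F)
    {x : EuclideanSpace ℝ (Fin 3)} {δ : ℝ} (hδ : 0 < δ) (hF0 : ∀ y ∈ ball x δ, F y = 0)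
    {e : EuclideanSpace ℝ (Fin 3)} (he : ‖e‖ = 1) :
    |⟪fderiv ℝ (biotSavart F) x e, e⟫| ≤ A * ∫ y, ‖F y - ⟪F y, e⟫ • e‖ * (‖x - y‖ ^ 3)⁻¹ := by
  rw [← integral_const_mul]
  exact abs_inner_fderiv_biotSavart_farField_le hK hFi hδ hF0 he
    (integrable_depletedMajorant hFi hδ hF0 he hK.nonneg) (fun y _ => le_of_eq (mul_assoc _ _ _))
    (fun y _ => by
      have := hK.nonneg
      positivity)

/-- **Parallel far vorticity does not stretch.** If the far field is everywhere parallel to `e` (`F y = c(y) e`),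
then `⟪∇(K ∗ F)(x) e, e⟫ = 0`: straight tubes, antiparallel pairs and unidirectional layers induce at the peak only
TRANSVERSE strain and rotation, no stretching along their own direction (Constantin's identity; Lemarié-Rieusset 2016,
proof of Thm. 11.7, `𝒜(t,x,y,x) = 0`). [cite: LemarieRieusset2016, Thm. 11.7 (proof, PDF p. 370)] -/
theorem inner_fderiv_biotSavart_farField_eq_zero_of_parallel
    {F : EuclideanSpace ℝ (Fin 3) → EuclideanSpace ℝ (Fin 3)} (hFi : Integrable F)
    {x : EuclideanSpace ℝ (Fin 3)} {δ : ℝ} (hδ : 0 < δ) (hF0 : ∀ y ∈ ball x δ, F y = 0)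
    (e : EuclideanSpace ℝ (Fin 3)) (c : EuclideanSpace ℝ (Fin 3) → ℝ) (hpar : ∀ y, F y = c y • e) :
    ⟪fderiv ℝ (biotSavart F) x e, e⟫ = 0 := by
  rw [inner_fderiv_biotSavart_farField hFi hδ hF0 e]
  refine integral_eq_zero_of_ae (Eventually.of_forall fun y => ?_)
  by_cases hy : y ∈ ball x δ
  · simp [hF0 y hy]
  · have hne : x - y ≠ 0 := by
      intro h
      apply hy
      rw [sub_eq_zero] at h
      rw [← h]
      exact mem_ball_self hδ
    simp only [Pi.zero_apply]
    rw [hpar y]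
    exact inner_fderiv_biotSavartCLM_apply_smul_self hne e e (c y)

/-! ### The `M⁻²` law from quadratic decay of the orthogonal component -/

/-- `n^{-5} = (n²)⁻¹ (n³)⁻¹` for `n > 0` (real power versus natural powers). [folklore] -/
theorem rpow_neg_five_eq {n : ℝ} (hn : 0 < n) : n ^ (-5 : ℝ) = (n ^ 2)⁻¹ * (n ^ 3)⁻¹ := by
  rw [Real.rpow_neg hn.le, show (5 : ℝ) = ((5 : ℕ) : ℝ) by norm_num, Real.rpow_natCast, ← mul_inv,
    ← pow_add]

/-- `∫_{|z| ≥ r} |z|⁻⁵ dz = (3|B₁|/2) r⁻²` on `ℝ³` (the tree's `integral_compl_ball_norm_rpow_neg` at `t = 5`).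
[folklore] -/
theorem integral_compl_ball_norm_rpow_neg_five {r : ℝ} (hr : 0 < r) :
    ∫ z in (ball (0 : EuclideanSpace ℝ (Fin 3)) r)ᶜ, ‖z‖ ^ (-5 : ℝ) =
      3 / 2 * (volume : Measure (EuclideanSpace ℝ (Fin 3))).real (ball 0 1) * (r ^ 2)⁻¹ := by
  rw [NewtonPotentialHolder.integral_compl_ball_norm_rpow_neg (t := 5) (by norm_num) hr]
  have h : r ^ ((3 : ℝ) - 5) = (r ^ 2)⁻¹ := by
    rw [show (3 : ℝ) - 5 = -2 by norm_num, Real.rpow_neg hr.le, show (2 : ℝ) = ((2 : ℕ) : ℝ) by norm_num,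
      Real.rpow_natCast]
  rw [h]
  ring

/-- **The `M⁻²` stretching law.** Let `F ∈ L¹` vanish on `B(x, Mρ)` (`ρ, M > 0`), `e` a unit vector, and suppose
the component of `F` orthogonal to `e` decays quadratically in core units beyond the ball:
`‖F y − ⟪F y, e⟫ e‖ ≤ m ρ² |x − y|⁻²` for `|y − x| ≥ Mρ`. Then
`|⟪∇(K ∗ F)(x) e, e⟫| ≤ (3|B₁|/2) A · m / M²` — the depleted bound integrated against `|x − y|⁻³`
(`∫_{|z| ≥ Mρ} |z|⁻⁵ = (3|B₁|/2)(Mρ)⁻²`). This is the rate `C/M²` of the re-typed crux obtained from DIRECTION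
COHERENCE across the shell, with no time integrability. [folklore] -/
theorem abs_inner_fderiv_biotSavart_farField_le_rate {A : ℝ} (hK : IsC1SingularKernel biotSavartCLM A)
    {F : EuclideanSpace ℝ (Fin 3) → EuclideanSpace ℝ (Fin 3)} (hFi : Integrable F)
    {x : EuclideanSpace ℝ (Fin 3)} {ρ M : ℝ} (hρ : 0 < ρ) (hM : 0 < M)
    (hF0 : ∀ y ∈ ball x (M * ρ), F y = 0) {e : EuclideanSpace ℝ (Fin 3)} (he : ‖e‖ = 1) {m : ℝ}
    (hdec : ∀ y, y ∉ ball x (M * ρ) → ‖F y - ⟪F y, e⟫ • e‖ ≤ m * ρ ^ 2 * (‖x - y‖ ^ 2)⁻¹) :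
    |⟪fderiv ℝ (biotSavart F) x e, e⟫| ≤
      3 / 2 * (volume : Measure (EuclideanSpace ℝ (Fin 3))).real (ball 0 1) * A * m / M ^ 2 := by
  have hA : 0 ≤ A := hK.nonneg
  have hδ : 0 < M * ρ := mul_pos hM hρ
  -- the radial majorant, centred at the origin, and its translate to `x`
  set h : EuclideanSpace ℝ (Fin 3) → ℝ :=
    (ball (0 : EuclideanSpace ℝ (Fin 3)) (M * ρ))ᶜ.indicator fun z => A * m * ρ ^ 2 * ‖z‖ ^ (-5 : ℝ) with hh
  have hhi : Integrable h := by
    rw [hh, integrable_indicator_iff measurableSet_ball.compl]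
    exact (NewtonPotentialHolder.integrableOn_compl_ball_norm_rpow_neg (t := 5) (by norm_num) hδ).const_mul
      (A * m * ρ ^ 2)
  have hint : ∫ y, h (x - y) = 3 / 2 * (volume : Measure (EuclideanSpace ℝ (Fin 3))).real (ball 0 1) * A * m / M ^ 2 := by
    rw [integral_sub_left_eq_self h volume x, hh, integral_indicator measurableSet_ball.compl,
      integral_const_mul, integral_compl_ball_norm_rpow_neg_five hδ]
    field_simp
  have hmem : ∀ y, y ∉ ball x (M * ρ) ↔ x - y ∈ (ball (0 : EuclideanSpace ℝ (Fin 3)) (M * ρ))ᶜ := by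
    intro y
    rw [mem_compl_iff, mem_ball, mem_ball_zero_iff, dist_eq_norm, norm_sub_rev]
  rw [← hint]
  refine abs_inner_fderiv_biotSavart_farField_le hK hFi hδ hF0 he (hhi.comp_sub_left x) ?_ ?_
  · intro y hy
    have hy' := (hmem y).1 hy
    have hn : 0 < ‖x - y‖ := by
      have : M * ρ ≤ ‖x - y‖ := by simpa [mem_ball_zero_iff] using hy'
      exact hδ.trans_le this
    rw [hh, indicator_of_mem hy', rpow_neg_five_eq hn]
    calc A * ‖F y - ⟪F y, e⟫ • e‖ * (‖x - y‖ ^ 3)⁻¹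
        ≤ A * (m * ρ ^ 2 * (‖x - y‖ ^ 2)⁻¹) * (‖x - y‖ ^ 3)⁻¹ := by
          gcongr
          exact hdec y hy
      _ = A * m * ρ ^ 2 * ((‖x - y‖ ^ 2)⁻¹ * (‖x - y‖ ^ 3)⁻¹) := by ring
  · intro y hy
    have hy' : x - y ∉ (ball (0 : EuclideanSpace ℝ (Fin 3)) (M * ρ))ᶜ := fun h' => ((hmem y).2 h') hy
    rw [hh, indicator_of_notMem hy']

/-- **The `M⁻²` stretching law, crux style** (absolute constant folded): there is `C ≥ 0` such that for every
far field `F ∈ L¹` vanishing on `B(x, Mρ)`, every unit `e` and every real `m` with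
`‖F y − ⟪F y, e⟫ e‖ ≤ m ρ² |x − y|⁻²` beyond the ball, `|⟪∇(K ∗ F)(x) e, e⟫| ≤ C · m / M²`. [folklore] -/
theorem farFieldStretch_rate : ∃ C : ℝ, 0 ≤ C ∧ ∀ (F : EuclideanSpace ℝ (Fin 3) → EuclideanSpace ℝ (Fin 3)) (x : EuclideanSpace ℝ (Fin 3)) (ρ M : ℝ) (e : EuclideanSpace ℝ (Fin 3)) (m : ℝ), 0 < ρ → 0 < M → MeasureTheory.Integrable F MeasureTheory.volume → (∀ y ∈ Metric.ball x (M * ρ), F y = 0) → ‖e‖ = 1 → (∀ y, y ∉ Metric.ball x (M * ρ) → ‖F y - inner ℝ (F y) e • e‖ ≤ m * ρ ^ 2 * (‖x - y‖ ^ 2)⁻¹) → |inner ℝ (fderiv ℝ (Literature.Analysis.FluidPDE.biotSavart F) x e) e| ≤ C * m / M ^ 2 := by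
  obtain ⟨A, hK⟩ := exists_isC1SingularKernel_biotSavartCLM
  refine ⟨3 / 2 * (volume : Measure (EuclideanSpace ℝ (Fin 3))).real (ball 0 1) * A, ?_, ?_⟩
  · have := hK.nonneg
    positivity
  · intro F x ρ M e m hρ hM hFi hF0 he hdec
    exact abs_inner_fderiv_biotSavart_farField_le_rate hK hFi hρ hM hF0 he hdec

/-- **Depleted far-field stretching bound, crux style** (absolute constant folded): there is `A ≥ 0` such that for
every far field `F ∈ L¹` vanishing on `B(x, δ)` and every unit `e`, `K ∗ F` is differentiable at `x` and
`|⟪∇(K ∗ F)(x) e, e⟫| ≤ A ∫ ‖F y − ⟪F y, e⟫ e‖ |x − y|⁻³ dy`. [cite: ConstantinFeffermanIndiana1993, §2 (the kernel estimate with the factor |sin φ|)] -/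
theorem farFieldStretch_depleted : ∃ A : ℝ, 0 ≤ A ∧ ∀ (F : EuclideanSpace ℝ (Fin 3) → EuclideanSpace ℝ (Fin 3)) (x : EuclideanSpace ℝ (Fin 3)) (δ : ℝ) (e : EuclideanSpace ℝ (Fin 3)), 0 < δ → MeasureTheory.Integrable F MeasureTheory.volume → (∀ y ∈ Metric.ball x δ, F y = 0) → ‖e‖ = 1 → DifferentiableAt ℝ (Literature.Analysis.FluidPDE.biotSavart F) x ∧ |inner ℝ (fderiv ℝ (Literature.Analysis.FluidPDE.biotSavart F) x e) e| ≤ A * ∫ y, ‖F y - inner ℝ (F y) e • e‖ * (‖x - y‖ ^ 3)⁻¹ := by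
  obtain ⟨A, hK⟩ := exists_isC1SingularKernel_biotSavartCLM
  exact ⟨A, hK.nonneg, fun F x δ e hδ hFi hF0 he =>
    ⟨differentiableAt_biotSavart_farField hFi hδ hF0,
      abs_inner_fderiv_biotSavart_farField_le_integral hK hFi hδ hF0 he⟩⟩

end Summit.NavierStokesRegularity.NavierStokesRegularity.Theorems.BlowupIsLocallyDriven.Depletion
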